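import Literature.IUT.HodgeArakelov.TemperedThetaMonoidsProofs
import Literature.IUT.HodgeArakelov.BadPrimeGaussianMonoidsProofs5
import Literature.IUT.HodgeArakelov.BadPrimeGaussianMonoidsSyncProofs
import HarnessLib

/-!
# [IUTchII] Cor 3.5 (ii) "⥤" at the `∞`-level / Remark 3.6.1 "involving the monoids `∞Ψ` [i.e., not just the
# monoids `Ψ`!]": diagonal `G_v,⟨F_l^⋇⟩`-stability of `∞Ψ_ξ` and Galois equivariance of the restriction
# isomorphism `∞Ψ^ι_env ⥲ ∞Ψ_ξ`, with conjugate synchronization of the constants DISCHARGED from Prop 3.1 (ii)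
# — `∞`-twin of `BadPrimeGaussianMonoidsSyncProofs.lean` §2–§3 / `…SyncMonoidProofs.lean` §2

S. Mochizuki, *Inter-universal Teichmüller theory II*, §3, kurims Dec-2020 manuscript (paper:url-5036b4059555),
Cor 3.5 (ii) p. 95: "`ξ^{ℚ≥0}` denotes the submonoid generated by the `N`-th roots [for `N ∈ ℕ_{≥1}`] of `ξ`
[which are uniquely determined, up to multiplication by an element of the `N`-torsion subgroup of
`Ψ^×_cns(M^Θ_*)_{⟨F_l^⋇⟩}`!] that arise by restricting elements of `∞θ^ι_env(M^Θ_*)`; each `Ψ_ξ(M^Θ_*)` is equipped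
with a natural action by `G_v(M^Θ_*▶)_{⟨F_l^⋇⟩}`" and the third display "`∞Ψ^ι_env(M^Θ_*) ⥲ ∞Ψ_ξ(M^Θ_*)` …
`↞` denotes the compatibility of the action of `G_v(M^Θ_*▶)_{|t|}` on the factor labeled `|t|` of the direct
product containing `∞Ψ_ξ(M^Θ_*)`"; Remark 3.6.1 p. 101: "The «Galois compatibility» denoted by the `↞` in the
third display of Corollaries 3.5, (ii); 3.6, (ii) — involving the monoids `∞Ψ` [i.e., not just the monoids
`Ψ`!] — corresponds precisely to the «Galois functoriality» [cf. Fig. 1.5] of the discussion of Remark 1.12.4"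
[cite: Mochizuki2012, Cor 3.5 (ii) p.95]. Claim key DISPUTED (D-0012). PROOF-ONLY companion (abc-iut cell,
layer L6, seat abc-iut-w5-d131; RQ7 note N1 on p415564: the `Ψ`-level Galois assembly of
`BadPrimeGaussianMonoidsSyncMonoidProofs.lean` has no `∞`-twin); NO definition, NO `Prop` fact, no instance.

WHAT IS IN THE TREE. The Galois SCHEMA at the `∞`-level with stability and synchronization as HYPOTHESES
(abc-iut-w5-d031 `BadPrimeGaussianMonoidsGaloisMonoidProofs.sourceIso_equivariant` / `mrange_pi_diagonalStable`;
abc-iut-w4-d004 `BadPrimeGaussianMonoidsProofs3.map_pi_diagonalStable`; abc-iut-w5-d086 Proofs5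
`restrictionIso'_equivariant`), the `∞`-restriction isomorphism itself (abc-iut-w5-d031
`BadPrimeGaussianMonoidsInftyRestrictionProofs.exists_unique_inftyRestrictionIso_inftyThetaMonoid`), and the
DISCHARGE of the two hypotheses for the `Ψ`-level monoid `M^×_TM · θ^ℕ` from the Kummer data of Prop 3.1 (ii)
(`BadPrimeGaussianMonoidsSyncProofs`: `sync_units_of_sections`, `splitMonoid_conjStable`, `sync_splitMonoid`;
`…SyncMonoidProofs`: `thetaSplit_conjStable_of_kummer`). WHAT IS SUPPLIED HERE is the same discharge for the
typed `∞Ψ^ι_env(M^Θ_*) = M^×_TM · ⟨∞θ^ι_env⟩` (`ThetaEnvData.inftyThetaMonoid ι`):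

* `splitMonoid_closure_conjStable`, `sync_splitMonoid_closure` — bookkeeping for `U · ⟨Θ⟩` with `Θ` a SET of
  generators (the `N`-th roots): stability from stability of `U` and "each root moves within its `U`-orbit";
  synchronization from synchronization on `U` and on the roots;
* `inftyThetaMonoid_conjStable_of_kummer`, `sync_inftyThetaMonoid_of_kummer` — at `∞Ψ^ι_env`, with the
  constant half DISCHARGED from the Kummer data (abc-iut-w4-d019 `units_conjStable_of_kummer`, d019/w5-d086
  `sync_units_of_sections`) and the root hypotheses kept in the PRINTED orbit form `hΘU` ("up to multiplication
  by an element of the `N`-torsion subgroup of `Ψ^×_cns`", p. 95 l. 2–5) and `hΘ` (synchronization on the roots);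
* `map_pi_inftyDiagonalStable_of_kummer` (restrictions typed out of the ambient group, as in `SyncProofs`) and
  `inftyRestrictionIso_equivariant_of_kummer` (restriction ISOMORPHISM typed out of the monoid `∞Ψ^ι_env`, as in
  Proofs4/5 and `InftyRestrictionProofs`) — "each `∞Ψ_ξ` is equipped with a natural action by `G_v,⟨F_l^⋇⟩`" and
  Remark 3.6.1's Galois functoriality AT THE `∞`-LEVEL; `_of_fixed` corollaries for sections fixing every root.

Residual named hypotheses, exactly as in the `Ψ`-level files: the per-label equivariance `hr` (print's "`↞`",
whose discharge belongs to the concrete restriction operations of Cor 2.8) and the root hypotheses `hΘU`/`hΘ`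
(resp. `hfix`). Nothing here asserts a disputed claim or takes a side on [IUTchIII] Cor 3.12; typed ≠ proved
≠ endorsed.
-/

namespace Literature.IUT.HodgeArakelov

namespace BadPrimeGaussianMonoids

open TemperedThetaMonoids

universe u v w

/-! ### 1. Bookkeeping on `U · ⟨Θ⟩` for a set `Θ` of generators -/

section SplitClosure

variable {H : Type u} [CommGroup H] {P : Type v} [Group P] {G : Type w} [Group G] {T : Type*}
  (conj : P →* MulAut H) (s : T → (G →* P))

/-- **IUTchII:Cor3.5(ii)** / **Prop3.1(i)** (kurims p.95, p.87) bookkeeping, `∞`-version of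
`splitMonoid_conjStable`: an element of `Π_X(M^Θ_*)` that stabilises the units `U = M^×_TM` and moves every
generator `ϑ ∈ Θ` (the roots `∞θ^ι_env`) within its `U`-orbit — print p. 95: roots "uniquely determined, up to
multiplication by an element of the `N`-torsion subgroup of `Ψ^×_cns`" — stabilises `U · ⟨Θ⟩`.
[cite: Mochizuki2012, Cor 3.5 (ii) p.95] -/
theorem splitMonoid_closure_conjStable (U : Subgroup H) (Θ : Set H) (p : P) (hU : ∀ u ∈ U, conj p u ∈ U)
    (hΘ : ∀ ϑ ∈ Θ, ∃ u ∈ U, conj p ϑ = u * ϑ) (x : H)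
    (hx : x ∈ splitMonoid U (Submonoid.closure Θ)) : conj p x ∈ splitMonoid U (Submonoid.closure Θ) := by
  obtain ⟨u, hu, y, hy, rfl⟩ := (mem_splitMonoid_iff _ _ _).mp hx
  clear hx
  rw [map_mul]
  refine Submonoid.mul_mem _ ((mem_splitMonoid_iff _ _ _).mpr ⟨conj p u, hU u hu, 1, Submonoid.one_mem _,
    mul_one _⟩) ?_
  induction hy using Submonoid.closure_induction with
  | mem ϑ hϑ =>
    obtain ⟨w, hw, hϑw⟩ := hΘ ϑ hϑ
    rw [hϑw]
    exact (mem_splitMonoid_iff _ _ _).mpr ⟨w, hw, ϑ, Submonoid.subset_closure hϑ, rfl⟩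
  | one => rw [map_one]; exact Submonoid.one_mem _
  | mul y z _ _ hy hz => rw [map_mul]; exact Submonoid.mul_mem _ hy hz

/-- **IUTchII:Cor3.5(ii)** (kurims p.95) bookkeeping, `∞`-version of `sync_splitMonoid`: actions through two
sections that agree on the units `U = M^×_TM` and on every generator `ϑ ∈ Θ` agree on the whole monoid
`U · ⟨Θ⟩`. [cite: Mochizuki2012, Cor 3.5 (ii) p.95] -/
theorem sync_splitMonoid_closure (U : Subgroup H) (Θ : Set H)
    (hU : ∀ g t t', ∀ u ∈ U, conj (s t g) u = conj (s t' g) u)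
    (hΘ : ∀ g t t', ∀ ϑ ∈ Θ, conj (s t g) ϑ = conj (s t' g) ϑ) (g : G) (t t' : T) (x : H)
    (hx : x ∈ splitMonoid U (Submonoid.closure Θ)) : conj (s t g) x = conj (s t' g) x := by
  obtain ⟨u, hu, y, hy, rfl⟩ := (mem_splitMonoid_iff _ _ _).mp hx
  have hy' : (conj (s t g)).toMonoidHom y = (conj (s t' g)).toMonoidHom y :=
    MonoidHom.eqOn_closureM (f := (conj (s t g)).toMonoidHom) (g := (conj (s t' g)).toMonoidHom)
      (fun ϑ hϑ => hΘ g t t' ϑ hϑ) hy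
  rw [map_mul, map_mul, hU g t t' u hu]
  exact congrArg (conj (s t' g) u * ·) hy'

/-- Sections FIXING every generator satisfy both root hypotheses (orbit form with the unit `1`, and
synchronization). [cite: Mochizuki2012, Cor 3.5 (ii) p.95] -/
theorem roots_orbit_of_fixed (U : Subgroup H) (Θ : Set H)
    (hfix : ∀ g t, ∀ ϑ ∈ Θ, conj (s t g) ϑ = ϑ) :
    (∀ g t t', ∀ ϑ ∈ Θ, conj (s t g) ϑ = conj (s t' g) ϑ) ∧
      ∀ g t, ∀ ϑ ∈ Θ, ∃ u ∈ U, conj (s t g) ϑ = u * ϑ :=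
  ⟨fun g t t' ϑ hϑ => by rw [hfix g t ϑ hϑ, hfix g t' ϑ hϑ],
    fun g t ϑ hϑ => ⟨1, U.one_mem, by rw [hfix g t ϑ hϑ, one_mul]⟩⟩

end SplitClosure

/-! ### 2. `∞Ψ^ι_env = M^×_TM · ⟨∞θ^ι_env⟩`: stability and synchronization with the constant half discharged -/

section InftyTheta

variable {S : ThetaSetting.{u}} (A : AbsTopMonoids S) (Pc : IsoClass S.PiX)
  (E : TemperedThetaMonoids.ThetaEnvData.{u, v} Pc.G) (κ : A.MTM Pc →* E.H)
  {G : Type w} [Group G] {T : Type*}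

/-- **IUTchII:Cor3.5(ii)** (kurims p.95) at the `∞`-level: `∞Ψ^ι_env(M^Θ_*) = M^×_TM · ⟨∞θ^ι_env⟩` is stable
under the elements `s_t(g)`, from the Kummer data of Prop 3.1 (ii) (units stable: abc-iut-w4-d019
`units_conjStable_of_kummer`) and the printed orbit hypothesis on the roots ("up to multiplication by an element
of the `N`-torsion subgroup of `Ψ^×_cns`"). [cite: Mochizuki2012, Cor 3.5 (ii) p.95] -/
theorem inftyThetaMonoid_conjStable_of_kummer (hcns : E.constantMonoid = MonoidHom.mrange κ)
    (hκeq : ∀ (x : Pc.G) (m : A.MTM Pc), κ (A.actMTM Pc x m) = E.conj x (κ m)) (s : T → (G →* Pc.G))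
    (ι : E.Iota) (hΘU : ∀ g t, ∀ ϑ ∈ E.inftyThetaEnv ι, ∃ u ∈ E.units, E.conj (s t g) ϑ = u * ϑ)
    (g : G) (t : T) : ∀ x ∈ E.inftyThetaMonoid ι, E.conj (s t g) x ∈ E.inftyThetaMonoid ι :=
  fun x hx => splitMonoid_closure_conjStable E.conj E.units (E.inftyThetaEnv ι) (s t g)
    (fun u hu => units_conjStable_of_kummer A Pc E κ hcns hκeq (s t g) u hu) (hΘU g t) x hx

/-- **IUTchII:Cor3.5(ii)** (kurims p.94–95) conjugate synchronization on `∞Ψ^ι_env(M^Θ_*)`: sections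
`s_t : G_v → Π_X(M^Θ_*)` agreeing modulo `Δ` act label-independently on `∞Ψ^ι_env`, the constant half being
DISCHARGED from the Kummer data of Prop 3.1 (ii) (`sync_units_of_sections`) and the root half kept named
(`hΘ`). [cite: Mochizuki2012, Cor 3.5 (ii) p.94] -/
theorem sync_inftyThetaMonoid_of_kummer (hκ : Function.Injective κ)
    (hcns : E.constantMonoid = MonoidHom.mrange κ)
    (hκeq : ∀ (x : Pc.G) (m : A.MTM Pc), κ (A.actMTM Pc x m) = E.conj x (κ m)) (s : T → (G →* Pc.G))
    (hs : ∀ t t' g, (QuotientGroup.mk (s t g) : Pc.G ⧸ A.Delta Pc) = QuotientGroup.mk (s t' g))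
    (ι : E.Iota) (hΘ : ∀ g t t', ∀ ϑ ∈ E.inftyThetaEnv ι, E.conj (s t g) ϑ = E.conj (s t' g) ϑ)
    (g : G) (t t' : T) : ∀ x ∈ E.inftyThetaMonoid ι, E.conj (s t g) x = E.conj (s t' g) x :=
  fun x hx => sync_splitMonoid_closure E.conj s E.units (E.inftyThetaEnv ι)
    (sync_units_of_sections A Pc E κ hκ hcns hκeq s hs) hΘ g t t' x hx

end InftyTheta

/-! ### 3. The diagonal `G_v,⟨F_l^⋇⟩`-stability of `∞Ψ_ξ` and Remark 3.6.1 at the `∞`-level -/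

section Assembly

variable {S : ThetaSetting.{u}} (A : AbsTopMonoids S) (Pc : IsoClass S.PiX)
  (E : TemperedThetaMonoids.ThetaEnvData.{u, v} Pc.G) (κ : A.MTM Pc →* E.H)
  {G : Type w} [Group G] {T : Type*} {M : Type*} [CommMonoid M]

/-- **IUTchII:Cor3.5(ii)** (kurims p.95) "⥤" at the `∞`-level, restrictions typed out of the ambient group
(as in `SyncProofs`): the image `∞Ψ_ξ` of `∞Ψ^ι_env(M^Θ_*)` under the product restriction is stable under the
DIAGONAL action `G_v(M^Θ_*▶)_{⟨F_l^⋇⟩}`, given (a) the Kummer data of Prop 3.1 (ii), (b) sections agreeing modulo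
`Δ`, (c) restrictions equivariant along the `s_t` (print's "`↞`"), and on the roots `∞θ^ι_env`: (d)
synchronization `hΘ` and (e) the orbit condition `hΘU`; the constant half of conjugate synchronization and the
stability of the units are PROVED from (a). [cite: Mochizuki2012, Cor 3.5 (ii) p.95] -/
theorem map_pi_inftyDiagonalStable_of_kummer (hκ : Function.Injective κ)
    (hcns : E.constantMonoid = MonoidHom.mrange κ)
    (hκeq : ∀ (x : Pc.G) (m : A.MTM Pc), κ (A.actMTM Pc x m) = E.conj x (κ m)) (s : T → (G →* Pc.G))
    (hs : ∀ t t' g, (QuotientGroup.mk (s t g) : Pc.G ⧸ A.Delta Pc) = QuotientGroup.mk (s t' g))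
    (β : G →* MulAut M) (r : T → (E.H →* M)) (hr : ∀ t g x, r t (E.conj (s t g) x) = β g (r t x))
    (ι : E.Iota) (hΘ : ∀ g t t', ∀ ϑ ∈ E.inftyThetaEnv ι, E.conj (s t g) ϑ = E.conj (s t' g) ϑ)
    (hΘU : ∀ g t, ∀ ϑ ∈ E.inftyThetaEnv ι, ∃ u ∈ E.units, E.conj (s t g) ϑ = u * ϑ) (t₀ : T) (g : G) :
    ((E.inftyThetaMonoid ι).map (MonoidHom.pi r)).map (piIso T (β g)).toMonoidHom =
      (E.inftyThetaMonoid ι).map (MonoidHom.pi r) :=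
  map_pi_diagonalStable E.conj s β r hr _ (sync_inftyThetaMonoid_of_kummer A Pc E κ hκ hcns hκeq s hs ι hΘ)
    (fun g t => inftyThetaMonoid_conjStable_of_kummer A Pc E κ hcns hκeq s ι hΘU g t) t₀ g

/-- **IUTchII:Cor3.5(ii)** (kurims p.95) at the `∞`-level, with the root hypotheses in the form "the `s_t(g)`
FIX every root" (sufficient, e.g. for sections landing in a subgroup acting trivially on the classes; print's
natural form at the `∞`-level is the orbit form of `map_pi_inftyDiagonalStable_of_kummer`).
[cite: Mochizuki2012, Cor 3.5 (ii) p.95] -/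
theorem map_pi_inftyDiagonalStable_of_kummer_of_fixed (hκ : Function.Injective κ)
    (hcns : E.constantMonoid = MonoidHom.mrange κ)
    (hκeq : ∀ (x : Pc.G) (m : A.MTM Pc), κ (A.actMTM Pc x m) = E.conj x (κ m)) (s : T → (G →* Pc.G))
    (hs : ∀ t t' g, (QuotientGroup.mk (s t g) : Pc.G ⧸ A.Delta Pc) = QuotientGroup.mk (s t' g))
    (β : G →* MulAut M) (r : T → (E.H →* M)) (hr : ∀ t g x, r t (E.conj (s t g) x) = β g (r t x))
    (ι : E.Iota) (hfix : ∀ g t, ∀ ϑ ∈ E.inftyThetaEnv ι, E.conj (s t g) ϑ = ϑ) (t₀ : T) (g : G) :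
    ((E.inftyThetaMonoid ι).map (MonoidHom.pi r)).map (piIso T (β g)).toMonoidHom =
      (E.inftyThetaMonoid ι).map (MonoidHom.pi r) :=
  map_pi_inftyDiagonalStable_of_kummer A Pc E κ hκ hcns hκeq s hs β r hr ι
    (roots_orbit_of_fixed E.conj s E.units (E.inftyThetaEnv ι) hfix).1
    (roots_orbit_of_fixed E.conj s E.units (E.inftyThetaEnv ι) hfix).2 t₀ g

/-- **IUTchII:Rmk3.6.1** (kurims p.101) "involving the monoids `∞Ψ` [i.e., not just the monoids `Ψ`!]": Galois
functoriality of the `∞`-restriction ISOMORPHISM of record (`exists_unique_inftyRestrictionIso_inftyThetaMonoid`,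
restriction typed OUT OF THE MONOID `∞Ψ^ι_env`): any `e : ∞Ψ^ι_env ⥲ ∞Ψ_ξ` pinned to the restriction is
`G_v`-equivariant (action through `s_{t₀}` on the source, diagonal action on `∞Ψ_ξ`), under the Kummer data of
Prop 3.1 (ii), sections agreeing modulo `Δ`, equivariant restrictions and the root hypotheses `hΘ`, `hΘU`
(via abc-iut-w5-d086's schema `restrictionIso'_equivariant`). [cite: Mochizuki2012, Rmk 3.6.1 p.101] -/
theorem inftyRestrictionIso_equivariant_of_kummer (hκ : Function.Injective κ)
    (hcns : E.constantMonoid = MonoidHom.mrange κ)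
    (hκeq : ∀ (x : Pc.G) (m : A.MTM Pc), κ (A.actMTM Pc x m) = E.conj x (κ m)) (s : T → (G →* Pc.G))
    (hs : ∀ t t' g, (QuotientGroup.mk (s t g) : Pc.G ⧸ A.Delta Pc) = QuotientGroup.mk (s t' g))
    (β : G →* MulAut M) (ι : E.Iota)
    (hΘ : ∀ g t t', ∀ ϑ ∈ E.inftyThetaEnv ι, E.conj (s t g) ϑ = E.conj (s t' g) ϑ)
    (hΘU : ∀ g t, ∀ ϑ ∈ E.inftyThetaEnv ι, ∃ u ∈ E.units, E.conj (s t g) ϑ = u * ϑ)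
    (r : T → (E.inftyThetaMonoid ι →* M))
    (hr : ∀ t g (x : E.inftyThetaMonoid ι),
      r t ⟨E.conj (s t g) x, inftyThetaMonoid_conjStable_of_kummer A Pc E κ hcns hκeq s ι hΘU g t x x.2⟩ =
        β g (r t x))
    {S' : Submonoid (T → M)} (e : E.inftyThetaMonoid ι ≃* S')
    (he : ∀ x, ((e x : S') : T → M) = MonoidHom.pi r x) (t₀ : T) (g : G) (x : E.inftyThetaMonoid ι) :
    ((e ⟨E.conj (s t₀ g) x, inftyThetaMonoid_conjStable_of_kummer A Pc E κ hcns hκeq s ι hΘU g t₀ x x.2⟩ :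
        S') : T → M) = piIso T (β g) (e x : T → M) :=
  restrictionIso'_equivariant E.conj s β _ r (inftyThetaMonoid_conjStable_of_kummer A Pc E κ hcns hκeq s ι hΘU)
    hr (sync_inftyThetaMonoid_of_kummer A Pc E κ hκ hcns hκeq s hs ι hΘ) e he t₀ g x

/-- **IUTchII:Rmk3.6.1** (kurims p.101) at the `∞`-level, with the root hypotheses in the form "the `s_t(g)` FIX
every root". [cite: Mochizuki2012, Rmk 3.6.1 p.101] -/
theorem inftyRestrictionIso_equivariant_of_kummer_of_fixed (hκ : Function.Injective κ)
    (hcns : E.constantMonoid = MonoidHom.mrange κ)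
    (hκeq : ∀ (x : Pc.G) (m : A.MTM Pc), κ (A.actMTM Pc x m) = E.conj x (κ m)) (s : T → (G →* Pc.G))
    (hs : ∀ t t' g, (QuotientGroup.mk (s t g) : Pc.G ⧸ A.Delta Pc) = QuotientGroup.mk (s t' g))
    (β : G →* MulAut M) (ι : E.Iota) (hfix : ∀ g t, ∀ ϑ ∈ E.inftyThetaEnv ι, E.conj (s t g) ϑ = ϑ)
    (r : T → (E.inftyThetaMonoid ι →* M))
    (hr : ∀ t g (x : E.inftyThetaMonoid ι),
      r t ⟨E.conj (s t g) x, inftyThetaMonoid_conjStable_of_kummer A Pc E κ hcns hκeq s ι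
        (roots_orbit_of_fixed E.conj s E.units (E.inftyThetaEnv ι) hfix).2 g t x x.2⟩ = β g (r t x))
    {S' : Submonoid (T → M)} (e : E.inftyThetaMonoid ι ≃* S')
    (he : ∀ x, ((e x : S') : T → M) = MonoidHom.pi r x) (t₀ : T) (g : G) (x : E.inftyThetaMonoid ι) :
    ((e ⟨E.conj (s t₀ g) x, inftyThetaMonoid_conjStable_of_kummer A Pc E κ hcns hκeq s ι
        (roots_orbit_of_fixed E.conj s E.units (E.inftyThetaEnv ι) hfix).2 g t₀ x x.2⟩ : S') : T → M) =
      piIso T (β g) (e x : T → M) :=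
  inftyRestrictionIso_equivariant_of_kummer A Pc E κ hκ hcns hκeq s hs β ι
    (roots_orbit_of_fixed E.conj s E.units (E.inftyThetaEnv ι) hfix).1
    (roots_orbit_of_fixed E.conj s E.units (E.inftyThetaEnv ι) hfix).2 r hr e he t₀ g x

end Assembly

end BadPrimeGaussianMonoids

end Literature.IUT.HodgeArakelov
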